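import Literature.NumberTheory.Rogawski1990.AnisotropicUnitarySemisimple
import Literature.NumberTheory.Rogawski1990.KottwitzSteinbergRankThree
import Literature.NumberTheory.Automorphic.UnitaryGroupDirectSum
import HarnessLib

/-!
# Singular semisimple elements of a unitary group in three variables, I: the adapted frame in which `γ = a·1₂ ⊕ b·1₁` and
# `H = H_a ⊕ H_b` (Rogawski 1990, §3.8, Prop. 3.8.1 (a): `G_γ ≅ U(2) × U(1)`-type)

Topic `NumberTheory/Rogawski1990`; namespace `Literature.NumberTheory.Rogawski1990`.  THEOREMS ONLY (no definition, no instance, no named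
fact, no `sorry`).  Pure linear algebra over a field `K` with an involution `σ`; the number-field∕adelic consequences (the centraliser of `γ`
in `U(H)(𝔸)` is `U(H_a)(𝔸) × U(H_b)(𝔸)`, orbital measures at singular classes) are drawn elsewhere.  Sequel: `SingularSemisimpleElement`
(the eigenvalue pair `{α, α, β}` of a semisimple, non-regular, non-central `γ`, which feeds the hypothesis `(γ − α)(γ − β) = 0` below).

Let `H ∈ M₃(K)` be `σ`-hermitian (`ᵗ(σH) = H`) with `det H ≠ 0` and `γ ∈ U_σ(H)(K) ≤ GL₃(K)` with `(γ − α)(γ − β) = 0`, `α ≠ β`,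
`γ ≠ α·1, β·1` — the singular, non-central, semisimple elements [Rogawski1990, §3.8]: eigenvalues `{α, α, β}`.  Then the eigenplane and the
eigenline are `H`-ORTHOGONAL, `σ(a)a = σ(b)b = 1`, and in an adapted basis `γ = a·1₂ ⊕ b·1₁`, `H = H_a ⊕ H_b` with `H_a`, `H_b` hermitian
non-degenerate — so that `G_γ = U(H_a) × U(H_b)` (Prop. 3.8.1 (a): «`G_γ ≅ H_ξ = H′_ξ × E¹`»).

* §1 `hermForm_congr`, `conjTranspose_mul_mul_apply` — bookkeeping: `ᵗ(σP) H P` is the Gram matrix `(⟨P eᵢ, P eⱼ⟩_H)` of the columns.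
* §2 **`exists_singular_frame`** — THE FRAME: there are `a ≠ b` with `{a, b} = {α, β}` (the `a`-eigenspace being the PLANE),
  `σ(a)a = σ(b)b = 1`, `P ∈ GL₃(K)` and hermitian non-degenerate `H_a ∈ M₂(K)`, `H_b ∈ M₁(K)` with `ᵗ(σP) · H · P = H_a ⊕ᶠ H_b` and
  `γ · P = P · (a·1₂ ⊕ᶠ b·1₁)` (★ `UnitaryGroup.finSum`).  The columns of `P` are a basis of the eigenplane followed by a basis of the
  eigenline; orthogonality and `σ(a)a = 1` come from unitarity — `⟨γu, γv⟩ = ⟨u, v⟩ ⇒ (σ(μ)ν − 1)⟨u, v⟩ = 0` on eigenvectors — and from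
  `det H ≠ 0`: a hermitian `3 × 3` Gram matrix with a totally isotropic plane, or with an isotropic line orthogonal to a plane, is singular.

## References
* J. Rogawski, *Automorphic Representations of Unitary Groups in Three Variables*, Ann. of Math. Stud. 123 (1990), §3.8 «Singular
  semisimple elements», Prop. 3.8.1 (a) p. 27; §1.9 (hermitian forms) [Rogawski1990].
-/

noncomputable section

namespace Literature.NumberTheory.Rogawski1990

open scoped MatrixGroups
open Matrix Polynomial Module
open Literature.AlgebraicGeometry.ShimuraVarieties (unitaryGroup mem_unitaryGroup_iff hermForm)
open Literature.NumberTheory.Automorphic.UnitaryGroup (finSum)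

/-! ## §1 Bookkeeping: congruent Gram matrices -/

section Gram

variable {K : Type*} [CommRing K] {n : Type*} [Fintype n] [DecidableEq n] (σ : K →+* K) (H : Matrix n n K)

omit [DecidableEq n] in
/-- `⟨u, v⟩_{ᵗ(σP) H P} = ⟨P u, P v⟩_H`. [cite: Rogawski1990, §1.9 p. 11] -/
theorem hermForm_congr (P : Matrix n n K) (u v : n → K) :
    hermForm σ ((P.map σ)ᵀ * H * P) u v = hermForm σ H (P *ᵥ u) (P *ᵥ v) := by
  have h1 : σ ∘ (P *ᵥ u) = (P.map σ) *ᵥ (σ ∘ u) := funext fun i => RingHom.map_mulVec σ P u i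
  simp only [hermForm]
  rw [h1, ← Matrix.vecMul_transpose (P.map σ) (σ ∘ u), ← Matrix.dotProduct_mulVec, Matrix.mulVec_mulVec, Matrix.mulVec_mulVec,
    Matrix.mul_assoc]

/-- The entries of `ᵗ(σP) H P` are the Gram values `⟨P eᵢ, P eⱼ⟩_H` of the columns of `P`. [cite: Rogawski1990, §1.9 p. 11] -/
theorem conjTranspose_mul_mul_apply (P : Matrix n n K) (i j : n) :
    ((P.map σ)ᵀ * H * P) i j = hermForm σ H (fun k => P k i) (fun k => P k j) := by
  have h := hermForm_single_single σ ((P.map σ)ᵀ * H * P) i j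
  rw [hermForm_congr] at h
  rw [← h]
  congr 1 <;> funext k <;> simp [Matrix.mulVec, dotProduct, Pi.single_apply]

end Gram

/-! ## §2 The adapted frame `P`: `γ P = P (a·1₂ ⊕ b·1₁)`, `ᵗ(σP) H P = H_a ⊕ H_b` -/

section Frame

variable {K : Type*} [Field K] (σ : K →+* K)

/-- Entries of `J₁ ⊕ᶠ J₂` (★ `finSum`): the four blocks. [folklore] -/
private theorem finSum_apply_inl_inl {S : Type*} [CommRing S] {N₁ N₂ : ℕ} (J₁ : Matrix (Fin N₁) (Fin N₁) S) (J₂ : Matrix (Fin N₂) (Fin N₂) S)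
    (i j : Fin N₁) : finSum N₁ N₂ J₁ J₂ (Fin.castAdd N₂ i) (Fin.castAdd N₂ j) = J₁ i j := by
  rw [← finSumFinEquiv_apply_left, ← finSumFinEquiv_apply_left]
  simp [finSum]

/-- Upper-right block of `J₁ ⊕ᶠ J₂` vanishes. [folklore] -/
private theorem finSum_apply_inl_inr {S : Type*} [CommRing S] {N₁ N₂ : ℕ} (J₁ : Matrix (Fin N₁) (Fin N₁) S)
    (J₂ : Matrix (Fin N₂) (Fin N₂) S) (i : Fin N₁) (j : Fin N₂) : finSum N₁ N₂ J₁ J₂ (Fin.castAdd N₂ i) (Fin.natAdd N₁ j) = 0 := by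
  rw [← finSumFinEquiv_apply_left, ← finSumFinEquiv_apply_right]
  simp [finSum]

/-- Lower-left block of `J₁ ⊕ᶠ J₂` vanishes. [folklore] -/
private theorem finSum_apply_inr_inl {S : Type*} [CommRing S] {N₁ N₂ : ℕ} (J₁ : Matrix (Fin N₁) (Fin N₁) S)
    (J₂ : Matrix (Fin N₂) (Fin N₂) S) (i : Fin N₂) (j : Fin N₁) : finSum N₁ N₂ J₁ J₂ (Fin.natAdd N₁ i) (Fin.castAdd N₂ j) = 0 := by
  rw [← finSumFinEquiv_apply_left, ← finSumFinEquiv_apply_right]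
  simp [finSum]

/-- Lower-right block of `J₁ ⊕ᶠ J₂` is `J₂`. [folklore] -/
private theorem finSum_apply_inr_inr {S : Type*} [CommRing S] {N₁ N₂ : ℕ} (J₁ : Matrix (Fin N₁) (Fin N₁) S) (J₂ : Matrix (Fin N₂) (Fin N₂) S)
    (i j : Fin N₂) : finSum N₁ N₂ J₁ J₂ (Fin.natAdd N₁ i) (Fin.natAdd N₁ j) = J₂ i j := by
  rw [← finSumFinEquiv_apply_right, ← finSumFinEquiv_apply_right]
  simp [finSum]

/-- A matrix with prescribed blocks IS `J₁ ⊕ᶠ J₂`. [folklore] -/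
private theorem eq_finSum_of_blocks {S : Type*} [CommRing S] {N₁ N₂ : ℕ} (G : Matrix (Fin (N₁ + N₂)) (Fin (N₁ + N₂)) S)
    (J₁ : Matrix (Fin N₁) (Fin N₁) S) (J₂ : Matrix (Fin N₂) (Fin N₂) S)
    (h₁₁ : ∀ i j, G (Fin.castAdd N₂ i) (Fin.castAdd N₂ j) = J₁ i j) (h₁₂ : ∀ i j, G (Fin.castAdd N₂ i) (Fin.natAdd N₁ j) = 0)
    (h₂₁ : ∀ i j, G (Fin.natAdd N₁ i) (Fin.castAdd N₂ j) = 0) (h₂₂ : ∀ i j, G (Fin.natAdd N₁ i) (Fin.natAdd N₁ j) = J₂ i j) :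
    G = finSum N₁ N₂ J₁ J₂ := by
  ext i j
  induction i using Fin.addCases with
  | left i => induction j using Fin.addCases with
    | left j => rw [h₁₁, finSum_apply_inl_inl]
    | right j => rw [h₁₂, finSum_apply_inl_inr]
  | right i => induction j using Fin.addCases with
    | left j => rw [h₂₁, finSum_apply_inr_inl]
    | right j => rw [h₂₂, finSum_apply_inr_inr]

/-- `a·1₂ ⊕ᶠ b·1₁` is the diagonal matrix `diag(a, a, b)`. [folklore] -/
private theorem finSum_smul_one (a b : K) :
    finSum 2 1 (a • (1 : Matrix (Fin 2) (Fin 2) K)) (b • (1 : Matrix (Fin 1) (Fin 1) K)) =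
      Matrix.diagonal (Fin.append (fun _ : Fin 2 => a) (fun _ : Fin 1 => b)) := by
  symm
  refine eq_finSum_of_blocks (Matrix.diagonal (Fin.append (fun _ : Fin 2 => a) (fun _ : Fin 1 => b)))
    (a • (1 : Matrix (Fin 2) (Fin 2) K)) (b • (1 : Matrix (Fin 1) (Fin 1) K))
    (fun i j => ?_) (fun i j => ?_) (fun i j => ?_) (fun i j => ?_)
  · rw [Matrix.diagonal_apply, Matrix.smul_apply, Matrix.one_apply, Fin.append_left]
    simp [Fin.ext_iff]
  · rw [Matrix.diagonal_apply_ne]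
    intro h
    have := congrArg Fin.val h
    simp at this
    omega
  · rw [Matrix.diagonal_apply_ne]
    intro h
    have := congrArg Fin.val h
    simp at this
    omega
  · rw [Matrix.diagonal_apply, Matrix.smul_apply, Matrix.one_apply, Fin.append_right]
    simp [Fin.ext_iff]

/-- THE FRAME, given the ordered eigen-decomposition (the plane `W₂` with eigenvalue `a`, the line `W₁` with eigenvalue `b`).
[cite: Rogawski1990, §3.8 Prop. 3.8.1 p. 27] -/
private theorem exists_frame_of_isCompl (hσ : ∀ x, σ (σ x) = x) (H : Matrix (Fin 3) (Fin 3) K) (hH : (H.map σ)ᵀ = H)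
    (hdet : H.det ≠ 0)
    (γ : unitaryGroup σ H) {a b : K} (hab : a ≠ b)
    (W₂ W₁ : Submodule K (Fin 3 → K)) (hW : IsCompl W₂ W₁) (h2 : finrank K W₂ = 2) (h1 : finrank K W₁ = 1)
    (haW : ∀ v ∈ W₂, ((γ : GL (Fin 3) K) : Matrix (Fin 3) (Fin 3) K) *ᵥ v = a • v)
    (hbW : ∀ v ∈ W₁, ((γ : GL (Fin 3) K) : Matrix (Fin 3) (Fin 3) K) *ᵥ v = b • v) :
    ∃ (P : GL (Fin 3) K) (Ha : Matrix (Fin 2) (Fin 2) K) (Hb : Matrix (Fin 1) (Fin 1) K),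
      σ a * a = 1 ∧ σ b * b = 1 ∧
      (((P : Matrix (Fin 3) (Fin 3) K)).map σ)ᵀ * H * (P : Matrix (Fin 3) (Fin 3) K) = finSum 2 1 Ha Hb ∧
      ((γ : GL (Fin 3) K) : Matrix (Fin 3) (Fin 3) K) * (P : Matrix (Fin 3) (Fin 3) K) =
        (P : Matrix (Fin 3) (Fin 3) K) * finSum 2 1 (a • (1 : Matrix (Fin 2) (Fin 2) K)) (b • (1 : Matrix (Fin 1) (Fin 1) K)) ∧
      (Ha.map σ)ᵀ = Ha ∧ (Hb.map σ)ᵀ = Hb ∧ Ha.det ≠ 0 ∧ Hb.det ≠ 0 := by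
  classical
  -- bases and the frame matrix
  let b₂ : Basis (Fin 2) K W₂ := Module.finBasisOfFinrankEq K W₂ h2
  let b₁ : Basis (Fin 1) K W₁ := Module.finBasisOfFinrankEq K W₁ h1
  let e : (W₂ × W₁) ≃ₗ[K] (Fin 3 → K) := Submodule.prodEquivOfIsCompl W₂ W₁ hW
  let B : Basis (Fin 3) K (Fin 3 → K) := ((b₂.prod b₁).map e).reindex finSumFinEquiv
  have hBl : ∀ i : Fin 2, B (Fin.castAdd 1 i) = (b₂ i : Fin 3 → K) := by
    intro i
    rw [← finSumFinEquiv_apply_left]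
    simp [B, e, Basis.reindex_apply, Basis.map_apply, Basis.prod_apply, Submodule.coe_prodEquivOfIsCompl']
  have hBr : ∀ j : Fin 1, B (Fin.natAdd 2 j) = (b₁ j : Fin 3 → K) := by
    intro j
    rw [← finSumFinEquiv_apply_right]
    simp [B, e, Basis.reindex_apply, Basis.map_apply, Basis.prod_apply, Submodule.coe_prodEquivOfIsCompl']
  -- eigen-relations of the columns
  let d : Fin 3 → K := Fin.append (fun _ : Fin 2 => a) (fun _ : Fin 1 => b)
  have hBd : ∀ j : Fin (2 + 1), ((γ : GL (Fin 3) K) : Matrix (Fin 3) (Fin 3) K) *ᵥ B j = d j • B j := by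
    intro j
    induction j using Fin.addCases with
    | left j' =>
      rw [hBl]
      simp only [d, Fin.append_left]
      exact haW _ (b₂ j').2
    | right j' =>
      rw [hBr]
      simp only [d, Fin.append_right]
      exact hbW _ (b₁ j').2
  -- `P` and its inverse
  let P : Matrix (Fin 3) (Fin 3) K := (Pi.basisFun K (Fin 3)).toMatrix B
  let P' : Matrix (Fin 3) (Fin 3) K := B.toMatrix (Pi.basisFun K (Fin 3))
  have hPapply : ∀ i j, P i j = B j i := fun i j => by simp [P, Basis.toMatrix_apply]
  have hPP' : P * P' = 1 := Basis.toMatrix_mul_toMatrix_flip _ _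
  have hP'P : P' * P = 1 := Basis.toMatrix_mul_toMatrix_flip _ _
  let Pu : GL (Fin 3) K := ⟨P, P', hPP', hP'P⟩
  have hdetP : P.det ≠ 0 := by
    intro h0
    have h := congrArg Matrix.det hPP'
    rw [Matrix.det_mul, h0, zero_mul, Matrix.det_one] at h
    exact zero_ne_one h
  -- `γ P = P diag(d)`
  have hγP : ((γ : GL (Fin 3) K) : Matrix (Fin 3) (Fin 3) K) * P = P * Matrix.diagonal d := by
    ext i j
    have h := congrFun (hBd j) i
    rw [Matrix.mul_diagonal, Matrix.mul_apply]
    simp only [Matrix.mulVec, dotProduct, Pi.smul_apply, smul_eq_mul] at h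
    simp only [hPapply]
    rw [h, mul_comm]
  -- the Gram matrix and its entries
  set G : Matrix (Fin 3) (Fin 3) K := (P.map σ)ᵀ * H * P with hGdef
  have hGij : ∀ i j, G i j = hermForm σ H (B i) (B j) := by
    intro i j
    rw [hGdef, conjTranspose_mul_mul_apply]
    simp only [hPapply]
  have hrel : ∀ i j, (σ (d i) * d j - 1) * G i j = 0 := by
    intro i j
    have h := hermForm_mulVec_mulVec σ H γ.2 (B i) (B j)
    rw [hBd, hBd, hermForm_smul_left, hermForm_smul_right] at h
    rw [hGij]
    linear_combination h
  have hdetG : G.det ≠ 0 := by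
    rw [hGdef, Matrix.det_mul, Matrix.det_mul, Matrix.det_transpose, ← RingHom.mapMatrix_apply, ← RingHom.map_det]
    exact mul_ne_zero (mul_ne_zero ((map_ne_zero σ).2 hdetP) hdet) hdetP
  have hd0 : d 0 = a := Fin.append_left (fun _ : Fin 2 => a) (fun _ : Fin 1 => b) (0 : Fin 2)
  have hd1 : d 1 = a := Fin.append_left (fun _ : Fin 2 => a) (fun _ : Fin 1 => b) (1 : Fin 2)
  have hd2 : d 2 = b := Fin.append_right (fun _ : Fin 2 => a) (fun _ : Fin 1 => b) (0 : Fin 1)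
  -- (i) `σ a · a = 1`: otherwise the plane is totally isotropic and `det G = 0`
  have haa : σ a * a = 1 := by
    by_contra h
    have hz : ∀ i j, d i = a → d j = a → G i j = 0 := by
      intro i j hi hj
      have := hrel i j
      rw [hi, hj] at this
      exact (mul_eq_zero.1 this).resolve_left (sub_ne_zero.2 h)
    apply hdetG
    rw [Matrix.det_fin_three, hz 0 0 hd0 hd0, hz 0 1 hd0 hd1, hz 1 0 hd1 hd0, hz 1 1 hd1 hd1]
    ring
  have hσa0 : σ a ≠ 0 := fun h => by rw [h, zero_mul] at haa; exact zero_ne_one haa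
  -- (ii) the plane and the line are orthogonal
  have hab' : σ a * b - 1 ≠ 0 := by
    intro h
    apply hab
    rw [sub_eq_zero] at h
    exact mul_left_cancel₀ hσa0 (haa.trans h.symm)
  have hba' : σ b * a - 1 ≠ 0 := by
    intro h
    apply hab'
    rw [sub_eq_zero] at h ⊢
    have := congrArg σ h
    rwa [map_mul, hσ, map_one, mul_comm] at this
  have hz02 : G 0 2 = 0 := by have := hrel 0 2; rw [hd0, hd2] at this; exact (mul_eq_zero.1 this).resolve_left hab'
  have hz12 : G 1 2 = 0 := by have := hrel 1 2; rw [hd1, hd2] at this; exact (mul_eq_zero.1 this).resolve_left hab'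
  have hz20 : G 2 0 = 0 := by have := hrel 2 0; rw [hd2, hd0] at this; exact (mul_eq_zero.1 this).resolve_left hba'
  have hz21 : G 2 1 = 0 := by have := hrel 2 1; rw [hd2, hd1] at this; exact (mul_eq_zero.1 this).resolve_left hba'
  -- (iii) `σ b · b = 1`: otherwise the last row of `G` vanishes
  have hbb : σ b * b = 1 := by
    by_contra h
    have hz22 : G 2 2 = 0 := by
      have := hrel 2 2
      rw [hd2] at this
      exact (mul_eq_zero.1 this).resolve_left (sub_ne_zero.2 h)
    apply hdetG
    rw [Matrix.det_fin_three, hz20, hz21, hz22]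
    ring
  -- the blocks
  let Ha : Matrix (Fin 2) (Fin 2) K := fun i j => G (Fin.castAdd 1 i) (Fin.castAdd 1 j)
  let Hb : Matrix (Fin 1) (Fin 1) K := fun i j => G (Fin.natAdd 2 i) (Fin.natAdd 2 j)
  have hcross₁ : ∀ (i : Fin 2) (j : Fin 1), G (Fin.castAdd 1 i) (Fin.natAdd 2 j) = 0 := by
    intro i j
    fin_cases i <;> fin_cases j
    · exact hz02
    · exact hz12
  have hcross₂ : ∀ (i : Fin 1) (j : Fin 2), G (Fin.natAdd 2 i) (Fin.castAdd 1 j) = 0 := by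
    intro i j
    fin_cases i; fin_cases j
    · exact hz20
    · exact hz21
  have hGsum : G = finSum 2 1 Ha Hb :=
    eq_finSum_of_blocks G Ha Hb (fun _ _ => rfl) hcross₁ hcross₂ (fun _ _ => rfl)
  -- `G` is hermitian, hence so are its diagonal blocks
  have hGherm : (G.map σ)ᵀ = G := by
    have hσσ : (σ : K → K) ∘ σ = id := funext hσ
    have hA : ((P.map σ)ᵀ.map σ)ᵀ = P := by
      rw [← Matrix.transpose_map, Matrix.transpose_transpose, Matrix.map_map, hσσ, Matrix.map_id]
    calc (G.map σ)ᵀ = (((P.map σ)ᵀ * H * P).map σ)ᵀ := by rw [hGdef]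
      _ = ((P.map σ)ᵀ.map σ * H.map σ * P.map σ)ᵀ := by rw [Matrix.map_mul, Matrix.map_mul]
      _ = (P.map σ)ᵀ * ((H.map σ)ᵀ * ((P.map σ)ᵀ.map σ)ᵀ) := by rw [Matrix.transpose_mul, Matrix.transpose_mul]
      _ = G := by rw [hH, hA, ← Matrix.mul_assoc, hGdef]
  have hGhermij : ∀ i j, σ (G j i) = G i j := fun i j => by
    have h := congrFun (congrFun hGherm i) j
    rwa [Matrix.transpose_apply, Matrix.map_apply] at h
  have hHa : (Ha.map σ)ᵀ = Ha := by
    ext i j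
    simp only [Matrix.transpose_apply, Matrix.map_apply, Ha]
    exact hGhermij _ _
  have hHb : (Hb.map σ)ᵀ = Hb := by
    ext i j
    simp only [Matrix.transpose_apply, Matrix.map_apply, Hb]
    exact hGhermij _ _
  -- determinants of the blocks
  have hdetblocks : Ha.det * Hb.det ≠ 0 := by
    have h : G.det = Ha.det * Hb.det := by
      rw [hGsum, finSum, Matrix.det_reindex_self, Matrix.det_fromBlocks_zero₂₁]
    rwa [h] at hdetG
  refine ⟨Pu, Ha, Hb, haa, hbb, hGsum, ?_, hHa, hHb, left_ne_zero_of_mul hdetblocks, right_ne_zero_of_mul hdetblocks⟩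
  show ((γ : GL (Fin 3) K) : Matrix (Fin 3) (Fin 3) K) * P = P * finSum 2 1 (a • 1) (b • 1)
  rw [finSum_smul_one, hγP]

/-- **The adapted frame of a singular, non-central, semisimple element** [Rogawski1990, §3.8]: `K` a field, `σ` an involution of
`K`, `H ∈ M₃(K)` hermitian with `det H ≠ 0`, `γ ∈ U_σ(H)(K)` with `(γ − α)(γ − β) = 0` for some `α ≠ β` and `γ ≠ α·1, β·1`.  Then, for the
ordering `{a, b} = {α, β}` in which the `a`-eigenspace is the PLANE: `σ(a)a = σ(b)b = 1` and there are `P ∈ GL₃(K)` and hermitian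
non-degenerate `H_a ∈ M₂(K)`, `H_b ∈ M₁(K)` with `ᵗ(σP) H P = H_a ⊕ᶠ H_b` and `γ P = P (a·1₂ ⊕ᶠ b·1₁)` — the eigenplane and the
eigenline are `H`-orthogonal and carry the non-degenerate forms `H_a`, `H_b`, so that `G_γ = U(H_a) × U(H_b)` (Prop. 3.8.1 (a):
«`G_γ ≅ H_ξ = H′_ξ × E¹`»). [cite: Rogawski1990, §3.8 Prop. 3.8.1 p. 27] -/
theorem exists_singular_frame (hσ : ∀ x, σ (σ x) = x) (H : Matrix (Fin 3) (Fin 3) K) (hH : (H.map σ)ᵀ = H) (hdet : H.det ≠ 0)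
    (γ : unitaryGroup σ H) {α β : K} (hαβ : α ≠ β)
    (hγ : (((γ : GL (Fin 3) K) : Matrix (Fin 3) (Fin 3) K) - α • 1) * (((γ : GL (Fin 3) K) : Matrix (Fin 3) (Fin 3) K) - β • 1) = 0)
    (hα : ((γ : GL (Fin 3) K) : Matrix (Fin 3) (Fin 3) K) ≠ α • 1) (hβ : ((γ : GL (Fin 3) K) : Matrix (Fin 3) (Fin 3) K) ≠ β • 1) :
    ∃ (a b : K) (P : GL (Fin 3) K) (Ha : Matrix (Fin 2) (Fin 2) K) (Hb : Matrix (Fin 1) (Fin 1) K),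
      ((a = α ∧ b = β) ∨ (a = β ∧ b = α)) ∧ σ a * a = 1 ∧ σ b * b = 1 ∧
      (((P : Matrix (Fin 3) (Fin 3) K)).map σ)ᵀ * H * (P : Matrix (Fin 3) (Fin 3) K) = finSum 2 1 Ha Hb ∧
      ((γ : GL (Fin 3) K) : Matrix (Fin 3) (Fin 3) K) * (P : Matrix (Fin 3) (Fin 3) K) =
        (P : Matrix (Fin 3) (Fin 3) K) * finSum 2 1 (a • (1 : Matrix (Fin 2) (Fin 2) K)) (b • (1 : Matrix (Fin 1) (Fin 1) K)) ∧
      (Ha.map σ)ᵀ = Ha ∧ (Hb.map σ)ᵀ = Hb ∧ Ha.det ≠ 0 ∧ Hb.det ≠ 0 := by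
  classical
  set M : Matrix (Fin 3) (Fin 3) K := ((γ : GL (Fin 3) K) : Matrix (Fin 3) (Fin 3) K) with hMdef
  set f : Module.End K (Fin 3 → K) := Matrix.toLin' M with hfdef
  -- the eigenspaces, as kernels of `f − α`, `f − β`
  let Vα : Submodule K (Fin 3 → K) := LinearMap.ker (Polynomial.aeval f (X - C α))
  let Vβ : Submodule K (Fin 3 → K) := LinearMap.ker (Polynomial.aeval f (X - C β))
  have haeval : ∀ (μ : K) (v : Fin 3 → K), Polynomial.aeval f (X - C μ) v = M *ᵥ v - μ • v := by
    intro μ v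
    simp [hfdef, Matrix.toLin'_apply]
  have hmemα : ∀ v, v ∈ Vα ↔ M *ᵥ v = α • v := fun v => by
    simp only [Vα, LinearMap.mem_ker, haeval, sub_eq_zero]
  have hmemβ : ∀ v, v ∈ Vβ ↔ M *ᵥ v = β • v := fun v => by
    simp only [Vβ, LinearMap.mem_ker, haeval, sub_eq_zero]
  -- complementary: `X − α`, `X − β` are coprime and their product kills `f`
  have hcop : IsCoprime (X - C α) (X - C β) := Polynomial.isCoprime_X_sub_C_of_isUnit_sub (sub_ne_zero.2 hαβ).isUnit
  have hprod : Polynomial.aeval f ((X - C α) * (X - C β)) = 0 := by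
    apply LinearMap.ext
    intro v
    rw [map_mul, Module.End.mul_apply, haeval, haeval, LinearMap.zero_apply]
    have h := congrArg (fun A : Matrix (Fin 3) (Fin 3) K => A *ᵥ v) hγ
    simp only [Matrix.zero_mulVec, ← Matrix.mulVec_mulVec, Matrix.sub_mulVec, Matrix.smul_mulVec, Matrix.one_mulVec] at h
    exact h
  have hcompl : IsCompl Vα Vβ := by
    refine ⟨Polynomial.disjoint_ker_aeval_of_isCoprime f hcop, codisjoint_iff.2 ?_⟩
    show Vα ⊔ Vβ = ⊤
    rw [Polynomial.sup_ker_aeval_eq_ker_aeval_mul_of_coprime f hcop, hprod, LinearMap.ker_zero]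
  -- neither eigenspace is trivial
  have hαbot : Vα ≠ ⊥ := by
    intro h
    have htop : Vβ = ⊤ := by
      have := hcompl.sup_eq_top; rwa [h, bot_sup_eq] at this
    apply hβ
    ext i j
    have hv : M *ᵥ Pi.single j 1 = β • Pi.single j 1 := (hmemβ _).1 (htop ▸ Submodule.mem_top)
    have := congrFun hv i
    simpa [Matrix.mulVec_single_one, Matrix.smul_apply, Matrix.one_apply, Pi.single_apply] using this
  have hβbot : Vβ ≠ ⊥ := by
    intro h
    have htop : Vα = ⊤ := by
      have := hcompl.sup_eq_top; rwa [h, sup_bot_eq] at this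
    apply hα
    ext i j
    have hv : M *ᵥ Pi.single j 1 = α • Pi.single j 1 := (hmemα _).1 (htop ▸ Submodule.mem_top)
    have := congrFun hv i
    simpa [Matrix.mulVec_single_one, Matrix.smul_apply, Matrix.one_apply, Pi.single_apply] using this
  -- dimension count: `dim Vα + dim Vβ = 3`, both positive
  have hsum : finrank K Vα + finrank K Vβ = 3 := by
    rw [Submodule.finrank_add_eq_of_isCompl hcompl, Module.finrank_fin_fun]
  have hαpos : 1 ≤ finrank K Vα := Submodule.one_le_finrank_iff.2 hαbot
  have hβpos : 1 ≤ finrank K Vβ := Submodule.one_le_finrank_iff.2 hβbot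
  have haW : ∀ v ∈ Vα, M *ᵥ v = α • v := fun v hv => (hmemα v).1 hv
  have hbW : ∀ v ∈ Vβ, M *ᵥ v = β • v := fun v hv => (hmemβ v).1 hv
  by_cases h2 : finrank K Vα = 2
  · have h1 : finrank K Vβ = 1 := by omega
    obtain ⟨P, Ha, Hb, haa, hbb, hG, hγP, hHa, hHb, hda, hdb⟩ :=
      exists_frame_of_isCompl σ hσ H hH hdet γ hαβ Vα Vβ hcompl h2 h1 haW hbW
    exact ⟨α, β, P, Ha, Hb, Or.inl ⟨rfl, rfl⟩, haa, hbb, hG, hγP, hHa, hHb, hda, hdb⟩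
  · have h2' : finrank K Vβ = 2 := by omega
    have h1 : finrank K Vα = 1 := by omega
    obtain ⟨P, Ha, Hb, haa, hbb, hG, hγP, hHa, hHb, hda, hdb⟩ :=
      exists_frame_of_isCompl σ hσ H hH hdet γ (Ne.symm hαβ) Vβ Vα hcompl.symm h2' h1 hbW haW
    exact ⟨β, α, P, Ha, Hb, Or.inr ⟨rfl, rfl⟩, haa, hbb, hG, hγP, hHa, hHb, hda, hdb⟩

end Frame

end Literature.NumberTheory.Rogawski1990
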